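import Mathlib
import Summits.Ventures.DiscreteObjects.Mahler.CensusSearchPackedQ

/-!
# The census search with carried depth data and `Nat`-encoded children (venture `DiscreteObjects`, target L)

Cell `pub-namedobj`, seat `pub-namedobj-mahler-g23` (pipeline of seats g12–g22). Framing: lottery ticket; floor = certified bounds/negative
ranges.

Farm measurements (mahler g23, KERNEL-COST-g23.md) show that the kernel time of the packed census search `censusSearchQ` (mahler g20) is dominated
by the per-node BOOKKEEPING of the internal levels — `pre.length`, `T.getD n`, `QT.getD n`, and three or four `Int.emod` encodings per child —
not by the leaves and not by the big-number arithmetic.  `censusSearchN` is `censusSearchQ` with that bookkeeping removed: the depth `n`, the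
threshold and row suffixes `T.drop n` / `QT.drop n` and the slot multipliers `γ^(n+1)`, `γ^(2d-(n+1))` are CARRIED, and the children are indexed by
`j : ℕ` with every encoded quantity computed by `Nat` modular arithmetic from `enc lo` and the Newton slot (`(enc lo + j) % W`, …).  It is
EXTENSIONALLY EQUAL to `censusSearchQ` (`censusSearchN_eq`), so the transfer `forall_certX_of_allCertifiedQs` carries over verbatim
(`forall_certX_of_allCertifiedNs`); measured ≈ 1.3–1.5× faster per subtree (N1: 36.5 → 24.7 s of kernel work).  Infrastructure only; no census row
is claimed here.
-/

namespace Summit.Ventures.DiscreteObjects.Mahler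

open Polynomial

/-! ## The search -/

/-- **`censusSearchQ` with carried depth data and `Nat`-encoded children.** Invariants (supplied by `censusSearchNs`): `n = pre.length`,
`Ts = T.drop n`, `Qs = QT.drop n`, `g = γ^(n+1)`, `gm = γ^(2d-(n+1))`. -/
def censusSearchN (T : List ℕ) (CT : List (List (List ℤ × ℤ))) (d NJ : ℕ) :
    ℕ → ℕ → List ℕ → List (List (ℤ × ℕ × ℤ)) → ℕ → ℕ → List ℤ → List ℤ → ℕ → ℕ → ℕ → ℕ → List (List ℤ)
  | 0, _, _, _, _, _, pre, ps, _, _, _, _ => if leafPass (palC pre) (T.drop pre.length) ps then [pre] else []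
  | fuel + 1, n, Ts, Qs, g, gm, pre, ps, Sacc, Cacc, Hacc, Dacc =>
    let slot := Cacc * Sacc / g % pW
    let R : ℤ := -decZ slot
    let kz : ℤ := ((n + 1 : ℕ) : ℤ)
    let Tk : ℤ := ((Ts.headD 0 : ℕ) : ℤ)
    let b := cutBoundsQ (Qs.headD []) Sacc g (-Tk) Tk
    let lo := -((b.2 - R) / kz)
    let hi := (R - b.1) / kz
    let elo := enc lo
    let eR := (pW - slot) % pW
    if fuel = 0 then
      let h := g * gm
      (List.range (hi + 1 - lo).toNat).flatMap fun j =>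
        let eak := (elo + j) % pW
        let cf := Cacc + eak * g + Hacc + h
        let Z := cf * (Sacc + ((eR + (n + 1) * (pW - eak)) % pW) * g) + (Dacc + enc ((2 * d : ℕ) : ℤ) * h)
        if leafLoopPJ cf (1 :: palC (pre ++ [lo + (j : ℤ)])) (2 * d) NJ Ts.tail Z (g * pG) then [pre ++ [lo + (j : ℤ)]] else []
    else (List.range (hi + 1 - lo).toNat).flatMap fun j =>
      let eak := (elo + j) % pW
      let eP := (eR + (n + 1) * (pW - eak)) % pW
      if (lo + (j : ℤ)).natAbs ≤ 2 ^ 10 ∧ (eP + 1048576) % pW ≤ 2097152 then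
        censusSearchN T CT d NJ fuel (n + 1) Ts.tail Qs.tail (g * pG) (gm / pG) (pre ++ [lo + (j : ℤ)]) ((-(kz * (lo + (j : ℤ))) + R) :: ps)
          (Sacc + eP * g) (Cacc + eak * g) (Hacc + eak * gm) (Dacc + ((2 * d - (n + 1)) * eak % pW) * gm)
      else censusSearchC T CT fuel (pre ++ [lo + (j : ℤ)]) ((-(kz * (lo + (j : ℤ))) + R) :: ps)

/-- **The search from a node** (carried data and packed accumulators computed from the prefix `pre`). -/
def censusSearchNs (T : List ℕ) (CT : List (List (List ℤ × ℤ))) (QT : List (List (ℤ × ℕ × ℤ))) (d NJ fuel : ℕ) (pre : List ℤ) :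
    List (List ℤ) :=
  censusSearchN T CT d NJ fuel pre.length (T.drop pre.length) (QT.drop pre.length) (pG ^ (pre.length + 1)) (pG ^ (2 * d - (pre.length + 1))) pre
    (psumsRev pre pre.length) (packS (psumsRev pre pre.length)) (packFrom 1 pre) (packFrom (2 * d - pre.length) pre.reverse)
    (packFromD (2 * d - pre.length) pre.reverse)

/-! ## Modular-arithmetic identities of the encodings -/

/-- `enc (x + j) = (enc x + j) mod W`. -/
theorem enc_add_natCast (x : ℤ) (j : ℕ) : (enc x + j) % pW = enc (x + (j : ℤ)) := by
  unfold enc pW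
  omega

/-- `enc (-decZ s) = (W - s) mod W` for a slot value `s < W`. -/
theorem enc_neg_decZ (s : ℕ) (hs : s < pW) : (pW - s) % pW = enc (-decZ s) := by
  unfold enc decZ pW at *
  split_ifs with h <;> omega

/-- `enc (-(k·a) + r) = (enc r + k·(W - enc a)) mod W`. -/
theorem enc_newton_child (r a : ℤ) (k : ℕ) : (enc r + k * (pW - enc a)) % pW = enc (-(((k : ℕ) : ℤ) * a) + r) := by
  have ha : enc a ≤ pW := (enc_lt a).le
  have h1 : ((enc r : ℕ) : ℤ) = r % 18446744073709551616 := by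
    unfold enc; rw [Int.toNat_of_nonneg (Int.emod_nonneg _ (by norm_num))]
  have h2 : ((enc a : ℕ) : ℤ) = a % 18446744073709551616 := by
    unfold enc; rw [Int.toNat_of_nonneg (Int.emod_nonneg _ (by norm_num))]
  have h3 : ((enc (-(((k : ℕ) : ℤ) * a) + r) : ℕ) : ℤ) = (-(((k : ℕ) : ℤ) * a) + r) % 18446744073709551616 := by
    unfold enc; rw [Int.toNat_of_nonneg (Int.emod_nonneg _ (by norm_num))]
  apply Int.natCast_inj.mp
  rw [Int.natCast_mod, Int.natCast_add, Int.natCast_mul, Int.natCast_sub ha, h1, h2, h3]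
  unfold pW; push_cast
  have key : r % 18446744073709551616 + (k : ℤ) * (18446744073709551616 - a % 18446744073709551616) =
      (-((k : ℤ) * a) + r) + 18446744073709551616 * ((k : ℤ) + (k : ℤ) * (a / 18446744073709551616) - r / 18446744073709551616) := by
    rw [Int.emod_def, Int.emod_def]; ring
  rw [key, Int.add_mul_emod_self_left]

/-- `enc (m·a) = (m · enc a) mod W`. -/
theorem enc_natMul (m : ℕ) (a : ℤ) : m * enc a % pW = enc (((m : ℕ) : ℤ) * a) := by
  have h2 : ((enc a : ℕ) : ℤ) = a % 18446744073709551616 := by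
    unfold enc; rw [Int.toNat_of_nonneg (Int.emod_nonneg _ (by norm_num))]
  have h3 : ((enc (((m : ℕ) : ℤ) * a) : ℕ) : ℤ) = (((m : ℕ) : ℤ) * a) % 18446744073709551616 := by
    unfold enc; rw [Int.toNat_of_nonneg (Int.emod_nonneg _ (by norm_num))]
  apply Int.natCast_inj.mp
  rw [Int.natCast_mod, Int.natCast_mul, h2, h3]
  unfold pW; push_cast
  have key : (m : ℤ) * (a % 18446744073709551616) = (m : ℤ) * a + 18446744073709551616 * (-((m : ℤ) * (a / 18446744073709551616))) := by
    rw [Int.emod_def]; ring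
  rw [key, Int.add_mul_emod_self_left]

/-- Decoded slots are at most `2^63` in absolute value. -/
theorem natAbs_decZ_le (s : ℕ) (hs : s < pW) : (decZ s).natAbs ≤ 2 ^ 63 := by
  unfold decZ pW at *
  split_ifs with h <;> omega

/-- The `Nat` guard on the encoded power sum is the `Int` guard `|P| ≤ 2^20` (for `|P| < 2^63 + 2^17`). -/
theorem guardP_iff (P : ℤ) (hP : P.natAbs < 2 ^ 63 + 2 ^ 17) : (enc P + 1048576) % pW ≤ 2097152 ↔ P.natAbs ≤ 2 ^ 20 := by
  unfold enc pW
  omega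

/-! ## Extensional equality with `censusSearchQ` -/

/-- `flatMap` after `map`. -/
theorem flatMap_map_fun {α β γ : Type*} (l : List α) (h : α → γ) (f : γ → List β) :
    (l.map h).flatMap f = l.flatMap fun a => f (h a) := by
  induction l with
  | nil => rfl
  | cons a l ih => rw [List.map_cons, List.flatMap_cons, List.flatMap_cons, ih]

/-- `flatMap` is extensional in the function. -/
theorem flatMap_ext {α β : Type*} (l : List α) {f g : α → List β} (h : ∀ a, f a = g a) : l.flatMap f = l.flatMap g := by
  rw [show f = g from funext h]

/-- Head of a suffix. -/
theorem headD_drop_eq_getD {α : Type*} (l : List α) (n : ℕ) (a : α) : (l.drop n).headD a = l.getD n a := by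
  rw [List.headD_eq_head?_getD, List.head?_drop, List.getD_eq_getElem?_getD]

/-- **`censusSearchN` is `censusSearchQ`** (under the invariants of the carried data). -/
theorem censusSearchN_eq {T : List ℕ} {CT : List (List (List ℤ × ℤ))} {QT : List (List (ℤ × ℕ × ℤ))} {d NJ : ℕ} (hdl : d ≤ 62) :
    ∀ (fuel n : ℕ) (Ts : List ℕ) (Qs : List (List (ℤ × ℕ × ℤ))) (g gm : ℕ) (pre ps : List ℤ) (Sacc Cacc Hacc Dacc : ℕ),
      n = pre.length → pre.length + fuel = d → Ts = T.drop n → Qs = QT.drop n → g = pG ^ (n + 1) → gm = pG ^ (2 * d - (n + 1)) →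
      censusSearchN T CT d NJ fuel n Ts Qs g gm pre ps Sacc Cacc Hacc Dacc = censusSearchQ T CT QT d NJ fuel pre ps Sacc Cacc Hacc Dacc := by
  intro fuel
  induction fuel with
  | zero => intro n Ts Qs g gm pre ps Sacc Cacc Hacc Dacc _ _ _ _ _ _; rfl
  | succ fuel ih =>
    intro n Ts Qs g gm pre ps Sacc Cacc Hacc Dacc hn hd hTs hQs hg hgm
    subst hTs hQs hg hgm hn
    have hslot : Cacc * Sacc / pG ^ (pre.length + 1) % pW < pW := Nat.mod_lt _ pW_pos
    have hTk : (T.drop pre.length).headD 0 = T.getD pre.length 0 := headD_drop_eq_getD _ _ _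
    have hQk : (QT.drop pre.length).headD [] = QT.getD pre.length [] := headD_drop_eq_getD _ _ _
    have hTt : (T.drop pre.length).tail = T.drop (pre.length + 1) := List.tail_drop
    have hQt : (QT.drop pre.length).tail = QT.drop (pre.length + 1) := List.tail_drop
    have hggm : pG ^ (pre.length + 1) * pG ^ (2 * d - (pre.length + 1)) = pG ^ (2 * d) := by
      rw [← pow_add]; exact congrArg _ (by omega)
    have hgs : pG ^ (pre.length + 1) * pG = pG ^ (pre.length + 1 + 1) := (pow_succ _ _).symm
    rw [censusSearchN, censusSearchQ]
    dsimp only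
    rw [hTk, hQk]
    set R : ℤ := -decZ (Cacc * Sacc / pG ^ (pre.length + 1) % pW) with hR
    set kz : ℤ := ((pre.length + 1 : ℕ) : ℤ) with hkz
    set b := cutBoundsQ (QT.getD pre.length []) Sacc (pG ^ (pre.length + 1)) (-((T.getD pre.length 0 : ℕ) : ℤ))
      ((T.getD pre.length 0 : ℕ) : ℤ) with hb
    set lo := -((b.2 - R) / kz) with hlo
    set hi := (R - b.1) / kz with hhi
    have heR : ∀ a : ℤ, ((pW - Cacc * Sacc / pG ^ (pre.length + 1) % pW) % pW + (pre.length + 1) * (pW - enc a)) % pW =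
        enc (-(kz * a) + R) := by
      intro a
      rw [enc_neg_decZ _ hslot, ← hR, hkz]
      exact enc_newton_child R a (pre.length + 1)
    rw [icc]
    split_ifs with hf
    · -- last level
      rw [flatMap_map_fun]
      refine flatMap_ext _ fun j => ?_
      rw [enc_add_natCast, heR, hggm, hTt]
    · have hgd : pG ^ (2 * d - (pre.length + 1)) / pG = pG ^ (2 * d - (pre.length + 1 + 1)) := by
        rw [show 2 * d - (pre.length + 1) = 2 * d - (pre.length + 1 + 1) + 1 by omega, pow_succ, Nat.mul_div_cancel _ pG_pos]
      rw [flatMap_map_fun]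
      refine flatMap_ext _ fun j => ?_
      rw [enc_add_natCast, heR, hTt, hQt, hgs, hgd, enc_natMul]
      set ak : ℤ := lo + (j : ℤ) with hak
      set P : ℤ := -(kz * ak) + R with hP
      have hguard : (ak.natAbs ≤ 2 ^ 10 ∧ (enc P + 1048576) % pW ≤ 2097152) ↔ (ak.natAbs ≤ 2 ^ 10 ∧ P.natAbs ≤ 2 ^ 20) := by
        constructor
        · rintro ⟨h1, h2⟩
          refine ⟨h1, (guardP_iff P ?_).mp h2⟩
          have hRb : R.natAbs ≤ 2 ^ 63 := by rw [hR, Int.natAbs_neg]; exact natAbs_decZ_le _ hslot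
          have hkb : (kz * ak).natAbs ≤ 62 * 2 ^ 10 := by
            rw [Int.natAbs_mul, hkz, Int.natAbs_natCast]; exact Nat.mul_le_mul (by omega) h1
          have h3 : P.natAbs ≤ (kz * ak).natAbs + R.natAbs := by
            have := Int.natAbs_add_le (-(kz * ak)) R
            rwa [Int.natAbs_neg] at this
          exact lt_of_le_of_lt (h3.trans (Nat.add_le_add hkb hRb)) (by norm_num)
        · rintro ⟨h1, h2⟩
          exact ⟨h1, (guardP_iff P (lt_of_le_of_lt h2 (by norm_num))).mpr h2⟩
      simp only [hguard]
      split_ifs with hchk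
      · exact ih (pre.length + 1) _ _ _ _ (pre ++ [ak]) _ _ _ _ _ (by simp) (by simp; omega) rfl rfl rfl rfl
      · rfl

/-- **Kernel-check form** (as `forall_certX_of_allCertifiedQs`, for the N search): certificates for the survivors of `censusSearchNs` certify every
survivor of `censusSearchC` at a node carrying its own power sums. -/
theorem forall_certX_of_allCertifiedNs {Bn Bd d : ℕ} {L : List (List ℤ)} {LC : List (List ℤ × ℤ)} {T : List ℕ}
    {CT : List (List (List ℤ × ℤ))} {QT : List (List (ℤ × ℕ × ℤ))} (hT : ∀ t ∈ T, t < 2 ^ 61) (hTl : T.length ≤ 62)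
    (hdl : d ≤ 62) (hQT : QTablesOK CT QT d) {NJ fuel : ℕ} {pre : List ℤ} (h1 : 1 ≤ pre.length) (hd : pre.length + fuel = d)
    (hbpre : ∀ c ∈ pre, c.natAbs ≤ 2 ^ 10) (hbps : ∀ p ∈ psumsRev pre pre.length, p.natAbs ≤ 2 ^ 20) (certs : List CertX)
    (h : allCertifiedX Bn Bd d L LC (censusSearchNs T CT QT d NJ fuel pre) certs = true) :
    ∀ a ∈ censusSearchC T CT fuel pre (psumsRev pre pre.length), ∃ c, checkCertX Bn Bd d L LC (1 :: palC a) c = true := by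
  have hNQ : censusSearchNs T CT QT d NJ fuel pre = censusSearchQs T CT QT d NJ fuel pre :=
    censusSearchN_eq hdl fuel _ _ _ _ _ pre _ _ _ _ _ rfl hd rfl rfl rfl rfl
  rw [hNQ] at h
  exact forall_certX_of_allCertifiedQs hT hTl hdl hQT h1 hd hbpre hbps certs h

end Summit.Ventures.DiscreteObjects.Mahler
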